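import Summits.BirchSwinnertonDyer.BirchSwinnertonDyer.Theorems.ByReductionTypeAtTwoSupersingularFlatKummerConjugation
import Summits.BirchSwinnertonDyer.BirchSwinnertonDyer.Theorems.ByReductionTypeAtTwoSupersingularFlatKummerIndependence
import Summits.BirchSwinnertonDyer.BirchSwinnertonDyer.Theorems.ByReductionTypeAtTwoSupersingularFlatKummerCharacterLocal
import Summits.BirchSwinnertonDyer.BirchSwinnertonDyer.Theorems.ByReductionTypeAtTwoSupersingularIwasawaAlgebraBidualityTwist
import Mathlib.RingTheory.PowerSeries.Inverse
import HarnessLib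

/-!
# Route `ByReductionTypeAtTwo` (rung K4), crux `SupersingularRankZeroAtTwo` (item stmt-BirchSwinnertonDyer-19097), stub 5
# `stub_flatKernelCyclic` (hand h13), sub-hand h13b: **THE KUMMER INJECTION `Sel_∞ ⧸ Sel^• ↪ Λ^∨` AND `hcyc`** —
# for every number field `K`, prime `p`, `ℤ_p`-extension `κ` with normalised generator `γ`, finite place `v`, local lift `g`
# (`κ(res g) = 1`) and chromatic datum `(ap, c, •)`: **if `Ker Col^• = Λ ∙ z^•` then the `Λ`-module
# `Hom(Sel_{p^∞}(E/K_∞) ⧸ Sel^•(E/K_∞), ℚ/ℤ)` (`T = conj_γ − 1`) is CYCLIC** (cell `bsd-2adic`, seat `bsd-2adic-t42` GEN 45;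
# `--supports 19097`, helper; assembles K1 p824966, K2 p824988, K3 p825063, K4-algebra p825638, K4/K5-Galois (…FlatKummerConjugation))

HONEST FRAMING (D-0036/D-0054): THEOREMS ONLY (no definition, no named fact, no `sorry`, no instance).  The hypothesis
`Ker Col^• = Λ ∙ z` is h13a (LEAD ★★ p824030 at `p = 2`, modulo `e : H¹_Iw ≃ₗ Λ²` = K86); this file is h13b, the Kummer pairing,
generic.  MECHANISM (Kitajima–Otsuki (4.2) + Prop. 3.32 for Sprung's •-condition, in the tree's functional model of `H¹_Iw`):
the local Tate pairing character `Φ(c) = (w ↦ w(p^kQ)/p^k)` of a Kummer class `c = [x ⊗ p^{-k}]` (K2/K3: well defined, additive),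
composed with the orbit map `f ↦ f • z` of `Λ ∙ z = Ker Col^•`, is a character `j(c)` of `Λ` lying in `Λ^∨` (K1); `j` kills EXACTLY
`Sel^•` (the •-condition «`w(x) ∈ p^k ℤ_p` for all `w ∈ Ker Col^•`» at `ι`, and at every conjugate because `Γ_K = res(Γ_{K_v})·ker κ`
and a local `δ` acts on each layer as a natural power of `g`, under which `Λ ∙ z` is stable); and `j ∘ conj_γ = j ∘ (·E)`,
`E = (1+T)⁻¹` (`conj_γ = conj_{res g}`, Kummer point `g • Q`, `w(g•x) = (E•w)(x)`), so `j` intertwines `conj_γ − 1` with the shift by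
the associate `u = E − 1` of `T`, for which `Hom(Λ^∨, ℚ/ℤ)` is cyclic (p825638); cyclicity transfers along the injection (p824877 §5).
19097 OPEN (h13 ⟸ this ∘ h13a; h13a displayed: `e`/K86); nothing booked; BSD proved for no curve; typed ≠ proved.

* §1 `exists_kummerPairingHom` — `Φ : localKummer(E(K_∞·K_v)) →+ Hom(Hom(E(K_∞·K_v), ℤ_p), ℚ/ℤ)`, `Φ[x ⊗ p^{-k}] = e x k`.
* §2 `mem_sharpFlatLocalKummerOverOfEmb_iff_forall_apply_eq_zero` — `c ∈ E^•_{∞,ι}` iff `Φ(c)` kills `Ker Col^•` (K3).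
* §3 `exists_kummerCharacter` — `j : localKummer →+ Λ^∨`, `j(c) = Φ(c) ∘ (f ↦ f • z)` (K1); `kummerCharacter_conjH1_resGalOfEmb_apply`
  (K4 core: `j(conj_{res g} c)(f) = j(c)(E f)`).
* §4 `conjH1_mem_sharpFlatLocalKummerOverOfEmb_of_mem` — the `⨅_σ` COLLAPSE: for `Ker Col^• = Λ∙z`, the •-condition at `ι` implies it at
  every conjugate `conj_σ`.
* §5 **`exists_cyclic_quotientDual_of_colemanKer_eq_span`** — `hcyc` for every datum with `Ker Col^• = Λ ∙ z` (the injection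
  `Sel_∞ ⧸ Sel^• ↪ Λ^∨`, its kernel, its equivariance, and the transfer).

References: [KitajimaOtsuki2018] (4.2), Prop. 3.32; [Sprung2012] Def. 7.9–7.11; [Kobayashi2003] §2 p. 4; [GreenbergLNM1716] §1 p. 60; tree p824877–p825638.
-/

set_option autoImplicit false
-- the Theorems namespace of this sub repeats the summit name by design (D-0017 nested layout)
set_option linter.dupNamespace false

noncomputable section

open scoped Classical

universe u

namespace Summit.BirchSwinnertonDyer.BirchSwinnertonDyer.Theorems

namespace OddBlindNF

open NumberField IsDedekindDomain WeierstrassCurve Literature.NumberTheory.EllipticCurves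
  Literature.NumberTheory.EllipticCurves.Sprung2012 Literature.NumberTheory.EllipticCurves.Sprung2017
  Literature.NumberTheory.EllipticCurves.Kobayashi2003 Literature.NumberTheory.EllipticCurves.IwasawaDual
  Literature.NumberTheory.GaloisRepresentations Literature.Algebra.Module ZpExtension

section Local

variable {K : Type u} [Field K] {p : ℕ} [hp : Fact p.Prime] {κ : ZpExtension K p}
variable {E : Type u} [Field E] [Algebra K E] {ι : AlgebraicClosure K →ₐ[K] AlgebraicClosure E} {W : WeierstrassCurve K}
variable {e : localTowerPointsOfEmb κ ι W → ℕ → ((localTowerPointsOfEmb κ ι W →+ ℤ_[p]) →+ AddCircle (1 : ℚ))}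

/-! ### §1 The local Tate pairing character of a Kummer class -/

/-- Values of a pairing family depend only on the value `w(x)`: `w x = w' y ⇒ e x k w = e y k w'`. [folklore] -/
theorem padicPairingFamily_congr
    (he : ∀ (x : localTowerPointsOfEmb κ ι W) (k : ℕ) (z : localTowerPointsOfEmb κ ι W →+ ℤ_[p]) (a : ℤ),
      PadicInt.toZModPow k (z x) = (a : ZMod (p ^ k)) → e x k z = (((a : ℚ) / (p : ℚ) ^ k : ℚ) : AddCircle (1 : ℚ)))
    {x y : localTowerPointsOfEmb κ ι W} {k : ℕ} {w w' : localTowerPointsOfEmb κ ι W →+ ℤ_[p]} (h : w x = w' y) :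
    e x k w = e y k w' := by
  obtain ⟨a, ha⟩ := ZMod.intCast_surjective (PadicInt.toZModPow k (w x))
  rw [he x k w a ha.symm, he y k w' a (by rw [← h, ha])]

/-- **The local Tate pairing character `Φ` of Kummer classes.**  On the Kummer classes `c = [x ⊗ p^{-k}]` at `ι` (`x = p^kQ ∈ E(K_∞·K_v)`)
there is an additive `Φ : localKummer →+ Hom(Hom(E(K_∞·K_v), ℤ_p), ℚ/ℤ)` with `Φ(c) = e x k = (w ↦ w(x)/p^k)` for EVERY Kummer datum of
`c` (well defined by K3 `padicPairingFamily_eq_of_kummerData`; additive via the datum `(φ₁+φ₂, Q₁+Q₂, k₁+k₂)`).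
[cite: Sprung2012, Def. 7.9 and Lemma 7.10 (p. 1503)] [cite: Kobayashi2003, §2 p. 4] -/
theorem exists_kummerPairingHom
    (he : ∀ (x : localTowerPointsOfEmb κ ι W) (k : ℕ) (z : localTowerPointsOfEmb κ ι W →+ ℤ_[p]) (a : ℤ),
      PadicInt.toZModPow k (z x) = (a : ZMod (p ^ k)) → e x k z = (((a : ℚ) / (p : ℚ) ^ k : ℚ) : AddCircle (1 : ℚ))) :
    ∃ Φ : localKummerOverOfEmb W p κ.kerSubgroup ι (localTowerPointsOfEmb κ ι W) →+
        ((localTowerPointsOfEmb κ ι W →+ ℤ_[p]) →+ AddCircle (1 : ℚ)),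
      ∀ (c : localKummerOverOfEmb W p κ.kerSubgroup ι (localTowerPointsOfEmb κ ι W))
        (φ : contOneCocycles.{0, u} (discreteTopRep κ.kerSubgroup (W.geomPrimaryTorsion p)))
        (Q : localPoints W E) (k : ℕ) (hQ : (p ^ k) • Q ∈ localTowerPointsOfEmb κ ι W),
        oneCocycleClass (discreteTopRep κ.kerSubgroup (W.geomPrimaryTorsion p)) φ = (c : W.subgroupH1 p κ.kerSubgroup) →
        (∀ τ : localSubgroupOfEmb κ.kerSubgroup ι,
          pointsMapOfEmb W ι ((φ.1 (resGalSubgroupOfEmb κ.kerSubgroup ι τ) : W.geomPrimaryTorsion p) : W.geomPoints) =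
            (τ : Field.absoluteGaloisGroup E) • Q - Q) →
        Φ c = e ⟨(p ^ k) • Q, hQ⟩ k := by
  have hdata : ∀ c : localKummerOverOfEmb W p κ.kerSubgroup ι (localTowerPointsOfEmb κ ι W),
      ∃ (φ : contOneCocycles.{0, u} (discreteTopRep κ.kerSubgroup (W.geomPrimaryTorsion p))) (Q : localPoints W E) (k : ℕ),
        oneCocycleClass (discreteTopRep κ.kerSubgroup (W.geomPrimaryTorsion p)) φ = (c : W.subgroupH1 p κ.kerSubgroup) ∧
        (p ^ k) • Q ∈ localTowerPointsOfEmb κ ι W ∧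
        ∀ τ : localSubgroupOfEmb κ.kerSubgroup ι,
          pointsMapOfEmb W ι ((φ.1 (resGalSubgroupOfEmb κ.kerSubgroup ι τ) : W.geomPrimaryTorsion p) : W.geomPoints) =
            (τ : Field.absoluteGaloisGroup E) • Q - Q := fun c ↦ c.2
  choose φ Q k hφ hQ hτ using hdata
  refine ⟨AddMonoidHom.mk' (fun c ↦ e ⟨(p ^ k c) • Q c, hQ c⟩ (k c)) fun c₁ c₂ ↦ ?_, fun c φ' Q' k' hQ' hφ' hτ' ↦
    padicPairingFamily_eq_of_kummerData he ((hφ c).trans hφ'.symm) (hQ c) hQ' (hτ c) hτ'⟩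
  -- additivity: the datum `(φ₁ + φ₂, Q₁ + Q₂, k₁ + k₂)` of `c₁ + c₂`
  have hM : (p ^ (k c₁ + k c₂)) • (Q c₁ + Q c₂) ∈ localTowerPointsOfEmb κ ι W := by
    rw [smul_add]
    refine add_mem ?_ ?_
    · rw [pow_add, mul_comm, ← smul_smul]; exact AddSubgroup.nsmul_mem _ (hQ c₁) _
    · rw [pow_add, ← smul_smul]; exact AddSubgroup.nsmul_mem _ (hQ c₂) _
  have hsum : e ⟨(p ^ k (c₁ + c₂)) • Q (c₁ + c₂), hQ (c₁ + c₂)⟩ (k (c₁ + c₂)) = e ⟨_, hM⟩ (k c₁ + k c₂) := by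
    refine padicPairingFamily_eq_of_kummerData he (φ' := φ c₁ + φ c₂) ?_ (hQ (c₁ + c₂)) hM (hτ (c₁ + c₂)) fun τ ↦ ?_
    · rw [hφ, oneCocycleClass_add, hφ, hφ, AddSubgroup.coe_add]
    · rw [Submodule.coe_add, ContinuousMap.add_apply, AddSubgroup.coe_add, map_add, hτ c₁ τ, hτ c₂ τ, smul_add]
      abel
  have hx : (⟨(p ^ (k c₁ + k c₂)) • (Q c₁ + Q c₂), hM⟩ : localTowerPointsOfEmb κ ι W) =
      (p ^ k c₂) • (⟨(p ^ k c₁) • Q c₁, hQ c₁⟩ : localTowerPointsOfEmb κ ι W) +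
        (p ^ k c₁) • (⟨(p ^ k c₂) • Q c₂, hQ c₂⟩ : localTowerPointsOfEmb κ ι W) := by
    apply Subtype.ext
    show (p ^ (k c₁ + k c₂)) • (Q c₁ + Q c₂) = (p ^ k c₂) • ((p ^ k c₁) • Q c₁) + (p ^ k c₁) • ((p ^ k c₂) • Q c₂)
    rw [smul_smul, smul_smul, ← pow_add, ← pow_add, add_comm (k c₂) (k c₁), smul_add]
  show e ⟨(p ^ k (c₁ + c₂)) • Q (c₁ + c₂), hQ (c₁ + c₂)⟩ (k (c₁ + c₂)) =
    e ⟨(p ^ k c₁) • Q c₁, hQ c₁⟩ (k c₁) + e ⟨(p ^ k c₂) • Q c₂, hQ c₂⟩ (k c₂)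
  rw [hsum, hx, padicPairingFamily_add_left he, add_comm (k c₁) (k c₂), padicPairingFamily_pow_nsmul_left he,
    add_comm (k c₂) (k c₁), padicPairingFamily_pow_nsmul_left he]

/-! ### §2 The •-condition is «`Φ(c)` kills `Ker Col^•`» -/

/-- **`c ∈ E^•_{∞,ι}` iff the pairing character of `c` kills the annihilating set.**  For a Kummer class `c` with datum `(φ, Q, k)`
and any set `𝒦` of functionals: `c ∈ sharpFlatLocalKummerOverOfEmb … 𝒦 ↔ ∀ w ∈ 𝒦, e (p^kQ) k w = 0` (the class may be presented by
ANY datum: K3). [cite: Sprung2012, Def. 7.9 (p. 1503)] [cite: KitajimaOtsuki2018, (4.2) (arXiv:1607.03612 p. 19)] -/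
theorem mem_sharpFlatLocalKummerOverOfEmb_iff_forall_apply_eq_zero
    (he : ∀ (x : localTowerPointsOfEmb κ ι W) (k : ℕ) (z : localTowerPointsOfEmb κ ι W →+ ℤ_[p]) (a : ℤ),
      PadicInt.toZModPow k (z x) = (a : ZMod (p ^ k)) → e x k z = (((a : ℚ) / (p : ℚ) ^ k : ℚ) : AddCircle (1 : ℚ)))
    (𝒦 : Set (localTowerPointsOfEmb κ ι W →+ ℤ_[p])) {c : W.subgroupH1 p κ.kerSubgroup}
    {φ : contOneCocycles.{0, u} (discreteTopRep κ.kerSubgroup (W.geomPrimaryTorsion p))} {Q : localPoints W E} {k : ℕ}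
    (hQ : (p ^ k) • Q ∈ localTowerPointsOfEmb κ ι W)
    (hφ : oneCocycleClass (discreteTopRep κ.kerSubgroup (W.geomPrimaryTorsion p)) φ = c)
    (hτ : ∀ τ : localSubgroupOfEmb κ.kerSubgroup ι,
      pointsMapOfEmb W ι ((φ.1 (resGalSubgroupOfEmb κ.kerSubgroup ι τ) : W.geomPrimaryTorsion p) : W.geomPoints) =
        (τ : Field.absoluteGaloisGroup E) • Q - Q) :
    c ∈ sharpFlatLocalKummerOverOfEmb W p κ.kerSubgroup ι (localTowerPointsOfEmb κ ι W) 𝒦 ↔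
      ∀ w ∈ 𝒦, e ⟨(p ^ k) • Q, hQ⟩ k w = 0 := by
  constructor
  · rintro ⟨φ', Q', k', hQ', hφ', hdiv, hτ'⟩ w hw
    rw [padicPairingFamily_eq_of_kummerData he (hφ.trans hφ'.symm) hQ hQ' hτ hτ', padicPairingFamily_apply_eq_zero_iff he]
    exact hdiv w hw
  · intro h
    exact ⟨φ, Q, k, hQ, hφ, fun w hw ↦ (padicPairingFamily_apply_eq_zero_iff he _ _ _).mp (h w hw), hτ⟩

/-! ### §3 The Kummer character `j(c) = Φ(c) ∘ (f ↦ f • z) ∈ Λ^∨` and its behaviour under `conj_{res g}` -/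

variable {g : Field.absoluteGaloisGroup E} {QΛ : AddSubgroup (PowerSeries ℤ_[p] →+ AddCircle (1 : ℚ))}

/-- **The Kummer character `j : localKummer →+ Λ^∨`.**  For the action `moduleOfGenerator … hg`, a pairing family `e`, the discrete dual
`Λ^∨` (membership criterion `hQΛ`) and ANY functional `z`: `j(c) := Φ(c) ∘ (f ↦ f • z)`, i.e. `j[x ⊗ p^{-k}] = (f ↦ (f • z)(x)/p^k)`,
lies in `Λ^∨` (K1 `LambdaDual.comp_orbit_mem_dualLambda`) and is additive in `c` (§1).
[cite: Sprung2012, Def. 7.9 (p. 1503)] [cite: KitajimaOtsuki2018, (4.2) and Prop. 3.32 (arXiv:1607.03612 pp. 16, 19)] -/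
theorem exists_kummerCharacter (hg : κ.IsTopGenerator (resGalOfEmb ι g))
    (he : ∀ (x : localTowerPointsOfEmb κ ι W) (k : ℕ) (z : localTowerPointsOfEmb κ ι W →+ ℤ_[p]) (a : ℤ),
      PadicInt.toZModPow k (z x) = (a : ZMod (p ^ k)) → e x k z = (((a : ℚ) / (p : ℚ) ^ k : ℚ) : AddCircle (1 : ℚ)))
    (hQΛ : ∀ χ, χ ∈ QΛ ↔ ∃ n k : ℕ, (∀ f, χ (PowerSeries.X ^ n * f) = 0) ∧ (∀ f, χ ((p : PowerSeries ℤ_[p]) ^ k * f) = 0))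
    (z : localTowerPointsOfEmb κ ι W →+ ℤ_[p]) :
    letI := moduleOfGenerator κ ι W hg
    ∃ j : localKummerOverOfEmb W p κ.kerSubgroup ι (localTowerPointsOfEmb κ ι W) →+ QΛ,
      ∀ (c : localKummerOverOfEmb W p κ.kerSubgroup ι (localTowerPointsOfEmb κ ι W))
        (φ : contOneCocycles.{0, u} (discreteTopRep κ.kerSubgroup (W.geomPrimaryTorsion p)))
        (Q : localPoints W E) (k : ℕ) (hQ : (p ^ k) • Q ∈ localTowerPointsOfEmb κ ι W),
        oneCocycleClass (discreteTopRep κ.kerSubgroup (W.geomPrimaryTorsion p)) φ = (c : W.subgroupH1 p κ.kerSubgroup) →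
        (∀ τ : localSubgroupOfEmb κ.kerSubgroup ι,
          pointsMapOfEmb W ι ((φ.1 (resGalSubgroupOfEmb κ.kerSubgroup ι τ) : W.geomPrimaryTorsion p) : W.geomPoints) =
            (τ : Field.absoluteGaloisGroup E) • Q - Q) →
        ((j c : QΛ) : PowerSeries ℤ_[p] →+ AddCircle (1 : ℚ)) =
          (e ⟨(p ^ k) • Q, hQ⟩ k).comp ((smulAddHom (PowerSeries ℤ_[p]) (localTowerPointsOfEmb κ ι W →+ ℤ_[p])).flip z) := by
  letI := moduleOfGenerator κ ι W hg
  obtain ⟨Φ, hΦ⟩ := exists_kummerPairingHom he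
  let t : PowerSeries ℤ_[p] →+ (localTowerPointsOfEmb κ ι W →+ ℤ_[p]) :=
    (smulAddHom (PowerSeries ℤ_[p]) (localTowerPointsOfEmb κ ι W →+ ℤ_[p])).flip z
  let j' : localKummerOverOfEmb W p κ.kerSubgroup ι (localTowerPointsOfEmb κ ι W) →+ (PowerSeries ℤ_[p] →+ AddCircle (1 : ℚ)) :=
    ((AddMonoidHom.compHom (M := PowerSeries ℤ_[p])).flip t).comp Φ
  have hj' : ∀ c, j' c = (Φ c).comp t := fun c ↦ rfl
  have hmem : ∀ c, j' c ∈ QΛ := by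
    intro c
    obtain ⟨φ, Q, k, hφ, hQ, hτ⟩ := c.2
    rw [hj', hΦ c φ Q k hQ hφ hτ]
    exact LambdaDual.comp_orbit_mem_dualLambda hg he hQΛ _ k z
  refine ⟨j'.codRestrict QΛ hmem, fun c φ Q k hQ hφ hτ ↦ ?_⟩
  show j' c = _
  rw [hj', hΦ c φ Q k hQ hφ hτ]

/-- **K4 core: `j(conj_{res g} c)(f) = j(c)(E·f)`**, `(1+T)E = 1`.  The Kummer point of `conj_{res g} c` is `g • Q`
(`exists_conjH1_kummerData`) and `(f • z)(g • x) = ((E f) • z)(x)` (`apply_smul_point_eq_smul_apply`).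
[cite: Sprung2012, §2 p. 1486 (γ ↦ 1+T) and Def. 7.9 (p. 1503)] [cite: GreenbergLNM1716, §1 p. 60] -/
theorem kummerCharacter_conjH1_resGalOfEmb_apply (hg : κ.IsTopGenerator (resGalOfEmb ι g))
    (he : ∀ (x : localTowerPointsOfEmb κ ι W) (k : ℕ) (z : localTowerPointsOfEmb κ ι W →+ ℤ_[p]) (a : ℤ),
      PadicInt.toZModPow k (z x) = (a : ZMod (p ^ k)) → e x k z = (((a : ℚ) / (p : ℚ) ^ k : ℚ) : AddCircle (1 : ℚ)))
    {Einv : PowerSeries ℤ_[p]} (hE : (1 + PowerSeries.X) * Einv = 1) (z : localTowerPointsOfEmb κ ι W →+ ℤ_[p])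
    {j : localKummerOverOfEmb W p κ.kerSubgroup ι (localTowerPointsOfEmb κ ι W) →+ QΛ}
    (hj : letI := moduleOfGenerator κ ι W hg
      ∀ (c : localKummerOverOfEmb W p κ.kerSubgroup ι (localTowerPointsOfEmb κ ι W))
        (φ : contOneCocycles.{0, u} (discreteTopRep κ.kerSubgroup (W.geomPrimaryTorsion p)))
        (Q : localPoints W E) (k : ℕ) (hQ : (p ^ k) • Q ∈ localTowerPointsOfEmb κ ι W),
        oneCocycleClass (discreteTopRep κ.kerSubgroup (W.geomPrimaryTorsion p)) φ = (c : W.subgroupH1 p κ.kerSubgroup) →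
        (∀ τ : localSubgroupOfEmb κ.kerSubgroup ι,
          pointsMapOfEmb W ι ((φ.1 (resGalSubgroupOfEmb κ.kerSubgroup ι τ) : W.geomPrimaryTorsion p) : W.geomPoints) =
            (τ : Field.absoluteGaloisGroup E) • Q - Q) →
        ((j c : QΛ) : PowerSeries ℤ_[p] →+ AddCircle (1 : ℚ)) =
          (e ⟨(p ^ k) • Q, hQ⟩ k).comp ((smulAddHom (PowerSeries ℤ_[p]) (localTowerPointsOfEmb κ ι W →+ ℤ_[p])).flip z))
    (c : localKummerOverOfEmb W p κ.kerSubgroup ι (localTowerPointsOfEmb κ ι W))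
    (hc' : W.conjH1 p κ.kerSubgroup (resGalOfEmb ι g) (c : W.subgroupH1 p κ.kerSubgroup) ∈
      localKummerOverOfEmb W p κ.kerSubgroup ι (localTowerPointsOfEmb κ ι W)) (f : PowerSeries ℤ_[p]) :
    ((j ⟨_, hc'⟩ : QΛ) : PowerSeries ℤ_[p] →+ AddCircle (1 : ℚ)) f =
      ((j c : QΛ) : PowerSeries ℤ_[p] →+ AddCircle (1 : ℚ)) (Einv * f) := by
  letI := moduleOfGenerator κ ι W hg
  obtain ⟨φ, Q, k, hφ, hQ, hτ⟩ := c.2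
  obtain ⟨φ', hφ', hQ', hτ'⟩ := exists_conjH1_kummerData (W := W) g hQ hτ
  rw [hφ] at hφ'
  rw [hj c φ Q k hQ hφ hτ, hj ⟨_, hc'⟩ φ' (g • Q) k hQ' hφ' hτ', AddMonoidHom.comp_apply, AddMonoidHom.comp_apply,
    AddMonoidHom.flip_apply, AddMonoidHom.flip_apply, smulAddHom_apply, smulAddHom_apply]
  have hx : (⟨(p ^ k) • (g • Q), hQ'⟩ : localTowerPointsOfEmb κ ι W) =
      ⟨g • ((⟨(p ^ k) • Q, hQ⟩ : localTowerPointsOfEmb κ ι W) : localPoints W E),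
        smul_mem_localTowerPointsOfEmb κ ι W g hQ⟩ := Subtype.ext (smul_comm _ _ _)
  refine padicPairingFamily_congr he ?_
  rw [hx, apply_smul_point_eq_smul_apply hg hE, mul_smul]

/-! ### §4 The `⨅_σ` collapse: the •-condition at `ι` implies it at every conjugate -/

/-- **The •-condition at `ι` propagates to all conjugates** when `Ker Col^•` is a `Λ`-submodule `Λ ∙ z` of the functional model:
if `s` has a Kummer datum `(φ, Q, k)` at `ι` with `w(p^kQ) ∈ p^kℤ_p` for all `w ∈ Λ∙z`, then for EVERY `σ ∈ Γ_K` the class `conj_σ s`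
satisfies the same condition — `σ = res(δ)·h` (`exists_eq_resGalOfEmb_mul_of_isTopGenerator`), the datum of `conj_{res δ} s` is
`(φ^δ, δ•Q, k)`, `δ • x = g^m • x` on the layer of `x`, and `w(g^m•x) = (E^m•w)(x)` with `E^m • w ∈ Λ∙z`.
[cite: Sprung2012, Def. 7.11 (p. 1503)] [cite: KitajimaOtsuki2018, (4.2) (arXiv:1607.03612 p. 19)] -/
theorem conjH1_mem_sharpFlatLocalKummerOverOfEmb_of_mem (hg : κ.IsTopGenerator (resGalOfEmb ι g))
    (z : localTowerPointsOfEmb κ ι W →+ ℤ_[p]) {𝒦 : Set (localTowerPointsOfEmb κ ι W →+ ℤ_[p])}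
    (hKer : letI := moduleOfGenerator κ ι W hg; 𝒦 = (Submodule.span (PowerSeries ℤ_[p]) {z} : Set _))
    {s : W.subgroupH1 p κ.kerSubgroup}
    (hs : s ∈ sharpFlatLocalKummerOverOfEmb W p κ.kerSubgroup ι (localTowerPointsOfEmb κ ι W) 𝒦)
    (σ : Field.absoluteGaloisGroup K) :
    W.conjH1 p κ.kerSubgroup σ s ∈ sharpFlatLocalKummerOverOfEmb W p κ.kerSubgroup ι (localTowerPointsOfEmb κ ι W) 𝒦 := by
  letI := moduleOfGenerator κ ι W hg
  obtain ⟨Einv, hE⟩ : ∃ Einv : PowerSeries ℤ_[p], (1 + PowerSeries.X) * Einv = 1 :=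
    ⟨PowerSeries.invOfUnit (1 + PowerSeries.X) 1, PowerSeries.mul_invOfUnit _ _ (by simp)⟩
  obtain ⟨φ, Q, k, hQ, hφ, hdiv, hτ⟩ := hs
  obtain ⟨δ, h, hh, hσ⟩ := exists_eq_resGalOfEmb_mul_of_isTopGenerator hg σ
  rw [conjH1_eq_conjH1_resGalOfEmb (W := W) (p := p) hh hσ]
  obtain ⟨φ', hφ', hQ', hτ'⟩ := exists_conjH1_kummerData (W := W) δ hQ hτ
  rw [hφ] at hφ'
  refine ⟨φ', δ • Q, k, hQ', hφ', fun w hw ↦ ?_, hτ'⟩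
  -- `δ • x = g^m • x` on the layer of `x = p^k Q`
  obtain ⟨n, hn⟩ := exists_mem_localLayerPointsOfEmb_of_mem_localTowerPointsOfEmb κ ι W hQ
  obtain ⟨m, hm⟩ := exists_smul_eq_pow_smul_of_mem_layer (W := W) hg δ hn
  have hx : (⟨(p ^ k) • (δ • Q), hQ'⟩ : localTowerPointsOfEmb κ ι W) =
      ⟨g ^ m • ((⟨(p ^ k) • Q, hQ⟩ : localTowerPointsOfEmb κ ι W) : localPoints W E),
        smul_mem_localTowerPointsOfEmb κ ι W (g ^ m) hQ⟩ := Subtype.ext (by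
    show (p ^ k) • (δ • Q) = g ^ m • ((p ^ k) • Q)
    rw [smul_comm, hm])
  rw [hx, apply_pow_smul_point_eq_pow_smul_apply hg hE]
  refine hdiv _ ?_
  rw [hKer] at hw ⊢
  exact (Submodule.span (PowerSeries ℤ_[p]) {z}).smul_mem (Einv ^ m) hw

end Local

/-! ### §5 `hcyc`: `Hom(Sel_∞ ⧸ Sel^•, ℚ/ℤ)` is cyclic when `Ker Col^• = Λ ∙ z` -/

section Selmer

variable {K : Type u} [Field K] [NumberField K] (W : WeierstrassCurve K) {p : ℕ} [hp : Fact p.Prime] (κ : ZpExtension K p)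

/-- A Selmer class is a Kummer class of a tower point at the chosen place (`σ = 1` in K2). [cite: Kobayashi2003, Def. 1.1 and §2 p. 4] -/
theorem selmerInfty_le_localKummerOverOfEmb (v : HeightOneSpectrum (𝓞 K)) :
    W.selmerInfty κ ≤ localKummerOverOfEmb W p κ.kerSubgroup (closureEmb (K := K) (v.adicCompletion K))
      (localTowerPointsOfEmb κ (closureEmb (K := K) (v.adicCompletion K)) W) := by
  intro s hs
  have h := conjH1_mem_localKummerOverOfEmb_localTowerPoints W κ v 1 hs
  have h1 : W.conjH1 p κ.kerSubgroup (1 : Field.absoluteGaloisGroup K) = AddMonoidHom.id _ := W.conjH1_one_holds p κ.kerSubgroup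
  rwa [h1, AddMonoidHom.id_apply] at h

/-- **`hcyc` FROM `Ker Col^• = Λ ∙ z`.**  For every number field `K`, prime `p`, `ℤ_p`-extension `κ` with normalised generator `γ`
(`κ γ = 1`), finite place `v`, local lift `g` (`κ(res g) = 1`) and chromatic datum `(ap, c, •)`: if the annihilating set `Ker Col^•` of
Sprung's •-condition is the `Λ`-orbit of one functional, `Ker Col^• = Λ ∙ z` (action `moduleOfGenerator … hg`), then the `Λ`-module
`Hom(Sel_{p^∞}(E/K_∞) ⧸ Sel^•(E/K_∞), ℚ/ℤ)` (`T = conj_γ − 1`, structure `IsLocNil.module` of `isLocNil_quotient_sharpFlat`) is CYCLIC.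
PROOF: the Kummer character `j` (§3) restricted to `Sel_∞` descends to an INJECTION `Sel_∞ ⧸ Sel^• ↪ Λ^∨` (kernel = `Sel^•` by §2 + §4),
intertwining `conj_γ − 1` with the shift by `u = (1+T)⁻¹ − 1` (§3, `conjH1_eq_of_isTopGenerator`); `Hom(Λ^∨, ℚ/ℤ)` is cyclic for that
shift (`LambdaDual.exists_cyclic_characterModule_dualLambda_mul`, `T ∣ u ∣ T`) and cyclicity transfers along equivariant injections
(`LambdaDual.exists_cyclic_characterModule_of_injective`).  This is Kitajima–Otsuki's «`(Sel/Sel^•)^∨` is a quotient of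
`(H¹(k_∞,E[p^∞])/E^•_∞)^∨ ≅ Ker Col^• ≅ Λ`». [cite: KitajimaOtsuki2018, (4.2) and Prop. 3.32 (arXiv:1607.03612 pp. 16, 19)]
[cite: Sprung2012, Def. 7.9, Lemma 7.10, Def. 7.11 (p. 1503)] [cite: GreenbergLNM1716, §1 p. 60] -/
theorem exists_cyclic_quotientDual_of_colemanKer_eq_span {γ : Field.absoluteGaloisGroup K} (hγ : κ.IsTopGenerator γ)
    (v : HeightOneSpectrum (𝓞 K)) {g : Field.absoluteGaloisGroup (v.adicCompletion K)}
    (hg : κ.IsTopGenerator (resGalOfEmb (closureEmb (K := K) (v.adicCompletion K)) g))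
    (ap : ℤ) (c : ℕ → localPoints W (v.adicCompletion K)) (col : Chroma)
    (hKer : letI := moduleOfGenerator κ (closureEmb (K := K) (v.adicCompletion K)) W hg
      ∃ zf : localTowerPointsOfEmb κ (closureEmb (K := K) (v.adicCompletion K)) W →+ ℤ_[p],
        colemanKer κ (closureEmb (K := K) (v.adicCompletion K)) W ap g c col =
          (Submodule.span (PowerSeries ℤ_[p]) {zf} : Set _)) :
    letI := (isLocNil_quotient_sharpFlat (W := W) (κ := κ) (ι := closureEmb (K := K) (v.adicCompletion K))
      (ap := ap) (g := g) (c := c) (col := col) γ).module (A := AddCircle (1 : ℚ));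
    ∃ y₀ : W.selmerInfty κ ⧸ (sharpFlatSelmerInfty W κ (closureEmb (K := K) (v.adicCompletion K)) ap g c col).addSubgroupOf
        (W.selmerInfty κ) →+ AddCircle (1 : ℚ),
      ∀ y, ∃ f : IwasawaAlgebra p, f • y₀ = y := by
  set ι : AlgebraicClosure K →ₐ[K] AlgebraicClosure (v.adicCompletion K) := closureEmb (K := K) (v.adicCompletion K) with hι
  letI inst := moduleOfGenerator κ ι W hg
  obtain ⟨zf, hKer⟩ := hKer
  -- the pairing family, the discrete dual, the inverse of `1+T` and the shift by `u = E − 1`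
  obtain ⟨e, he⟩ := exists_padicPairingFamily (N := localTowerPointsOfEmb κ ι W) (p := p)
  obtain ⟨QΛ, hQΛ⟩ := LambdaDual.exists_dualLambda (p := p)
  obtain ⟨Einv, hE⟩ : ∃ Einv : PowerSeries ℤ_[p], (1 + PowerSeries.X) * Einv = 1 :=
    ⟨PowerSeries.invOfUnit (1 + PowerSeries.X) 1, PowerSeries.mul_invOfUnit _ _ (by simp)⟩
  have hXu : PowerSeries.X ∣ (Einv - 1) := ⟨-Einv, by linear_combination hE⟩
  have huX : (Einv - 1) ∣ PowerSeries.X := ⟨-(1 + PowerSeries.X), by linear_combination hE⟩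
  obtain ⟨ψ, hψ⟩ := LambdaDual.exists_dualLambda_shift_mul hQΛ (Einv - 1)
  have hQ' := LambdaDual.isLocNil_dualLambda_mul hQΛ hXu hψ
  have hcycΛ := LambdaDual.exists_cyclic_characterModule_dualLambda_mul hQΛ hXu huX hψ
  -- the Kummer character on Selmer classes
  obtain ⟨j, hj⟩ := exists_kummerCharacter (W := W) hg he hQΛ zf
  have hle := selmerInfty_le_localKummerOverOfEmb W κ v
  obtain ⟨j₁, hj₁⟩ : ∃ j₁ : W.selmerInfty κ →+ QΛ, ∀ s : W.selmerInfty κ,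
      j₁ s = j ⟨(s : W.subgroupH1 p κ.kerSubgroup), hle s.2⟩ := ⟨j.comp (AddSubgroup.inclusion hle), fun s ↦ rfl⟩
  -- K5: `j₁ s = 0 ↔ s ∈ Sel^•`
  have hker : ∀ s : W.selmerInfty κ, j₁ s = 0 ↔
      (s : W.subgroupH1 p κ.kerSubgroup) ∈ sharpFlatSelmerInfty W κ ι ap g c col := by
    intro s
    obtain ⟨φ, Q, k, hφ, hQ, hτ⟩ := hle s.2
    -- `j₁ s = 0` iff the •-condition at `ι`
    have hloc : j₁ s = 0 ↔ (s : W.subgroupH1 p κ.kerSubgroup) ∈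
        sharpFlatLocalKummerOverOfEmb W p κ.kerSubgroup ι (localTowerPointsOfEmb κ ι W) (colemanKer κ ι W ap g c col) := by
      rw [mem_sharpFlatLocalKummerOverOfEmb_iff_forall_apply_eq_zero he _ hQ hφ hτ, hj₁, ← Subtype.coe_inj, ZeroMemClass.coe_zero,
        hj _ φ Q k hQ hφ hτ, hKer]
      constructor
      · intro h w hw
        obtain ⟨f, rfl⟩ := Submodule.mem_span_singleton.mp hw
        have := DFunLike.congr_fun h f
        rwa [AddMonoidHom.comp_apply, AddMonoidHom.flip_apply, smulAddHom_apply, AddMonoidHom.zero_apply] at this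
      · intro h
        ext f
        rw [AddMonoidHom.comp_apply, AddMonoidHom.flip_apply, smulAddHom_apply, AddMonoidHom.zero_apply]
        exact h _ (Submodule.mem_span_singleton.mpr ⟨f, rfl⟩)
    rw [hloc, mem_sharpFlatSelmerInfty_iff]
    constructor
    · intro h
      exact ⟨s.2, fun σ ↦ conjH1_mem_sharpFlatLocalKummerOverOfEmb_of_mem (W := W) hg zf hKer h σ⟩
    · rintro ⟨-, h⟩
      have h1 := h 1
      have hone : W.conjH1 p κ.kerSubgroup (1 : Field.absoluteGaloisGroup K) = AddMonoidHom.id _ :=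
        W.conjH1_one_holds p κ.kerSubgroup
      rwa [hone, AddMonoidHom.id_apply] at h1
  -- the descended injection `jbar : Sel_∞ ⧸ Sel^• →+ Λ^∨`
  set N := (sharpFlatSelmerInfty W κ ι ap g c col).addSubgroupOf (W.selmerInfty κ) with hN
  have hNle : N ≤ j₁.ker := fun s hs ↦ (AddMonoidHom.mem_ker).mpr ((hker s).mpr (AddSubgroup.mem_addSubgroupOf.mp hs))
  obtain ⟨jbar, hjbar⟩ : ∃ jbar : W.selmerInfty κ ⧸ N →+ QΛ, ∀ s : W.selmerInfty κ, jbar (QuotientAddGroup.mk s) = j₁ s :=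
    ⟨QuotientAddGroup.lift N j₁ hNle, fun s ↦ QuotientAddGroup.lift_mk N hNle s⟩
  have hinj : Function.Injective jbar := by
    intro x y hxy
    obtain ⟨s, rfl⟩ := QuotientAddGroup.mk_surjective x
    obtain ⟨t, rfl⟩ := QuotientAddGroup.mk_surjective y
    rw [hjbar, hjbar, ← sub_eq_zero, ← map_sub, hker] at hxy
    rw [QuotientAddGroup.eq_iff_sub_mem]
    exact AddSubgroup.mem_addSubgroupOf.mpr hxy
  -- K4: equivariance `jbar ∘ (conj_γ − 1) = ψ_u ∘ jbar`
  have hconj : ∀ s : W.selmerInfty κ, ∀ f : PowerSeries ℤ_[p],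
      ((j₁ (W.conjSelmerInfty κ γ s) : QΛ) : PowerSeries ℤ_[p] →+ AddCircle (1 : ℚ)) f =
        ((j₁ s : QΛ) : PowerSeries ℤ_[p] →+ AddCircle (1 : ℚ)) (Einv * f) := by
    intro s f
    have hc' : W.conjH1 p κ.kerSubgroup (resGalOfEmb ι g) (s : W.subgroupH1 p κ.kerSubgroup) ∈
        localKummerOverOfEmb W p κ.kerSubgroup ι (localTowerPointsOfEmb κ ι W) := by
      rw [← conjH1_eq_of_isTopGenerator (W := W) (p := p) hγ hg]
      exact hle (W.conjSelmerInfty κ γ s).2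
    have heq : j₁ (W.conjSelmerInfty κ γ s) = j ⟨_, hc'⟩ := by
      rw [hj₁]
      congr 1
      apply Subtype.ext
      show W.conjH1 p κ.kerSubgroup γ s = W.conjH1 p κ.kerSubgroup (resGalOfEmb ι g) s
      rw [conjH1_eq_of_isTopGenerator (W := W) (p := p) hγ hg]
    rw [heq, hj₁]
    exact kummerCharacter_conjH1_resGalOfEmb_apply hg he hE zf hj ⟨(s : W.subgroupH1 p κ.kerSubgroup), hle s.2⟩ hc' f
  have hSψ := sharpFlat_addSubgroupOf_le_comap_conjSelmerInfty_sub_one (W := W) (κ := κ) (ι := ι) (ap := ap) (g := g)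
    (c := c) (col := col) γ
  have hjψ : ∀ x, jbar (QuotientAddGroup.map N N (W.conjSelmerInfty κ γ - 1 : AddMonoid.End (W.selmerInfty κ)) hSψ x) =
      ψ (jbar x) := by
    intro x
    obtain ⟨s, rfl⟩ := QuotientAddGroup.mk_surjective x
    have hmap : QuotientAddGroup.map N N (W.conjSelmerInfty κ γ - 1 : AddMonoid.End (W.selmerInfty κ)) hSψ
        (QuotientAddGroup.mk s) = QuotientAddGroup.mk (W.conjSelmerInfty κ γ s - s) := by
      rw [QuotientAddGroup.map_mk]; rfl
    rw [hmap, hjbar, hjbar, map_sub]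
    apply Subtype.ext
    rw [hψ, AddSubgroupClass.coe_sub]
    ext f
    rw [AddMonoidHom.sub_apply, hconj s f, AddMonoidHom.comp_apply, AddMonoidHom.coe_mulLeft, sub_mul, one_mul, map_sub]
  exact LambdaDual.exists_cyclic_characterModule_of_injective (isLocNil_quotient_sharpFlat (W := W) (κ := κ) (ι := ι)
    (ap := ap) (g := g) (c := c) (col := col) γ) hQ' jbar hinj hjψ hcycΛ

end Selmer

end OddBlindNF

end Summit.BirchSwinnertonDyer.BirchSwinnertonDyer.Theorems

end
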